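import Mathlib
import Summits.NavierStokesRegularity.NavierStokesRegularity.Theses.RootDecompLitSlice
import Summits.NavierStokesRegularity.NavierStokesRegularity.Theorems.RootDecompLitSliceCritTameScarIsCriticalClosed
import Summits.NavierStokesRegularity.NavierStokesRegularity.Theorems.RootDecompLitSliceNoDarkBallClosed
import Summits.NavierStokesRegularity.NavierStokesRegularity.Theorems.RootDecompLitSliceNoSupercriticalTameScarOfCells
import HarnessLib

/-!
# Route RootDecompLitSlice (decomp-ns node N16) — the ROOT cone after the closure of Uᶜ, BY NAME

Bookkeeping helper (`--supports stmt-NavierStokesRegularity-29565`, the parent U `NoSupercriticalTameScar`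
of the glued split Uᶜ ∧ Uᵃ): with both CLOSED cruxes of the route discharged by name — D `NoDarkBall`
(`Theorems.noDarkBall`) and ★ Uᶜ `CritTameScarIsCritical` (`CritTameScarIsCriticalClosed.critTameScarIsCritical_proof`,
census g58, p838867) — the route's gate-certified deciding theorem `RootDecompLitSlice.closes` reads

  ROOT `NavierStokesRegularity` ⟸ P1 `NoTypeIBlowup` ⟨1217⟩ ∧ P2 `NoEnergyAtom` ⟨24827⟩ ∧ J1 `AtomFreeBlowupIsTame` ⟨24829⟩
    ∧ Uᵃ `AbruptTameScarIsCritical` ⟨31734⟩ ∧ T₃ᴸ `NoLitInvisibleTransient` ⟨29562⟩ ∧ G₂ᴸ `LitCriticalSingularityIsTypeI` ⟨29564⟩,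

SIX open leaves (the kernel glue `LitSlice.noSupercriticalTameScar_of_cells_proof` rebuilds U from Uᶜ and Uᵃ).
`u_of_abrupt`: U ⟸ Uᵃ alone. HONEST FRAMING (D-0179): pure composition; the LOADS of the cell's blocker
(Uᵃ: Tao-II; P1: NSI-DSS / averaged Type-I) are untouched and the other four leaves are open; rung 0 —
nothing here proves Navier–Stokes regularity. [folklore]
-/

set_option linter.dupNamespace false

namespace Summit.NavierStokesRegularity.NavierStokesRegularity.Theorems

namespace RootOfLoads

open Summit.NavierStokesRegularity.NavierStokesRegularity.Theses.RootDecompLitSlice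

/-- **U ⟸ Uᵃ.** After the closure of Uᶜ ⟨31733⟩ (census g58, p838867), the parent crux U
`NoSupercriticalTameScar` ⟨29565⟩ follows from its abrupt cell Uᵃ `AbruptTameScarIsCritical` ⟨31734⟩ alone
(kernel glue `LitSlice.noSupercriticalTameScar_of_cells_proof`). [folklore] -/
theorem u_of_abrupt (hUa : AbruptTameScarIsCritical) : NoSupercriticalTameScar :=
  LitSlice.noSupercriticalTameScar_of_cells_proof CritTameScarIsCriticalClosed.critTameScarIsCritical_proof hUa

/-- ★ **The N16 root cone after Uᶜ: six open leaves.** `NavierStokesRegularity` follows from P1 ⟨1217⟩,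
P2 ⟨24827⟩, J1 ⟨24829⟩, Uᵃ ⟨31734⟩, T₃ᴸ ⟨29562⟩ and G₂ᴸ ⟨29564⟩ — the route's `closes` with D supplied by
`Theorems.noDarkBall` and U by `u_of_abrupt`. [folklore] -/
theorem root_of_six_leaves (hP1 : NoTypeIBlowup) (hP2 : NoEnergyAtom) (hJ1 : AtomFreeBlowupIsTame)
    (hUa : AbruptTameScarIsCritical) (hT : NoLitInvisibleTransient) (hG : LitCriticalSingularityIsTypeI) :
    NavierStokesRegularity :=
  closes hP1 hP2 hJ1 (u_of_abrupt hUa) hT hG Theorems.noDarkBall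

end RootOfLoads

end Summit.NavierStokesRegularity.NavierStokesRegularity.Theorems
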